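import Summits.CriticalPhenomena.PercolationContinuityZ3.Theses.PercPortalLadder
import Literature.Probability.Percolation.ConnectivityProofs
import Literature.Probability.Percolation.CoveringMonotonicity
import Literature.Probability.Percolation.HalfSpaceLemma752
import Literature.Probability.Percolation.SubgraphMonotonicity

/-!
# `PortalGridRung` is the summit in costume — the strategist's census theorems (r1, 2026-08-17)

Crux `Summit.CriticalPhenomena.PercolationContinuityZ3.Theses.PercPortalLadder.PortalGridRung`
(stmt-CriticalPhenomena-14516, route `route-CriticalPhenomena-PercPortalLadder`, rank 5, the deciding
crux of `closes`): `∃ k ≥ 2, ∀ v, θ_{G_{Π_k}}(v, p_c(ℤ³)) = 0`, where the RIVETED LATTICE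
`G_{Π_k} := ℤ³ ∖ gridWall k` is the cubic lattice with every crossing edge `s(x, x − e₀)`, `x₀ = 0`,
sealed except above the rivet grid `Π_k = {x₀ = 0, k ∣ x₁, k ∣ x₂}`.

Everything below is PROVED (no `sorry`). Writing `Rung k := ∀ v, θ_{G_{Π_k}}(v, p_c(ℤ³)) = 0`
(so the crux is `∃ k ≥ 2, Rung k`, `portalGridRung_iff`, by `Iff.rfl`) and `S` for the
sub-problem statement `PercolationContinuityZ3` (`θ_{ℤ³}(0, p_c) = 0`):

* `rung_one_iff` : `Rung 1 ↔ S` — the `k = 1` member of the family IS the summit conjunct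
  (`gridWall 1 = ∅`, `G_{Π_1} = ℤ³`);
* `rung_of_dvd` : `k ∣ k' → Rung k → Rung k'` — the family is monotone along divisibility
  (finer grids delete more edges; edge deletion lowers `θ`, `theta_deleteEdges_mono`, from the
  Lyons–Peres covering inequality `LyonsPeres647.theta_le_of_surjOn_neighborSet` with `φ = id`);
  hence `rung_of_continuity : S → Rung k` for EVERY `k` and `portalGridRung_of_continuity : S → crux`
  — the crux is a COROLLARY of the summit (its converse is the route's open same-`p` bridge
  `GridWallPersistence`, not touched here);
* `criticalProb_gridGraph_eq` : `p_c(G_{Π_k}, 0) = p_c(ℤ³, 0)` for EVERY `k` (sandwich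
  `ℍ = G_{Π_k}[x₀ ≥ 0] ⊆ G_{Π_k} ⊆ ℤ³` with `p_c(ℍ) = p_c`, `GrimmettMarstrand1990_halfSpace_holds`), and
  the riveted lattice has its transition exactly there: `theta_gridGraph_eq_zero_of_lt` (no
  percolation below `p_c(ℤ³)`), `theta_gridGraph_pos_of_lt` (percolation above it). Consequently
  `portalGridRung_iff_continuity_at_own_threshold` : the crux is LITERALLY "`θ = 0` at the critical
  point of the riveted cubic lattice itself", i.e. continuity of the percolation transition of a
  connected amenable 3D lattice graph that is neither (quasi-)planar (DST slabs), nor nested like a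
  half-space (BGN), nor high-dimensional (lace expansion) — the summit's own question for a
  one-parameter family of graphs whose `k = 1` member is `ℤ³`;
* `gridOpenPhase_iff_portalGridRung` : the load-bearing stub `GridOpenPhase` of the only registered
  line (`Cruxes/PortalGridRung/Lines/birth.lean`, "BGN Thm 1.2 (i) one rung up": the percolating
  phase of some `G_{Π_k}`, `k ≥ 2`, is open from the left) is EQUIVALENT to the crux given tree
  facts — the "transfer from the half-space" carries no content of its own: away from `p = p_c`
  openness is automatic (`theta_gridGraph_pos_of_lt` / `theta_gridGraph_eq_zero_of_lt`), and at
  `p = p_c` it is the crux.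

See `STRATEGY-CENSUS.md` in this directory for the census (Transfer / Strengthen / Decomposition /
Negation) these theorems support.
-/

noncomputable section

namespace Summit.CriticalPhenomena.PercolationContinuityZ3.Cruxes.PortalGridRung.Costume

open MeasureTheory Literature.Probability.Percolation Literature.Probability.LatticeModels
open Summit.CriticalPhenomena.PercolationContinuityZ3.Theses.PercPortalLadder (PortalGridRung)

/-! ## The rung family -/

/-- The SEALED WALL of spacing `k`: the crossing edges `s(x, x − e₀)`, `x₀ = 0`, NOT above the rivet
grid `Π_k = {x₀ = 0, k ∣ x₁, k ∣ x₂}` (verbatim the edge set deleted in the crux). -/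
def gridWall (k : ℕ) : Set (Sym2 (Site 3)) :=
  {e | ∃ x : Site 3, x 0 = 0 ∧ x ∉ {y : Site 3 | (k : ℤ) ∣ y 1 ∧ (k : ℤ) ∣ y 2} ∧
    e = s(x, x - Pi.single 0 1)}

/-- The RIVETED LATTICE `G_{Π_k} = ℤ³ ∖ gridWall k`. -/
def gridGraph (k : ℕ) : SimpleGraph (Site 3) := (zdGraph 3).deleteEdges (gridWall k)

/-- The `k`-th member of the rung family: no vertex of `G_{Π_k}` percolates at `p_c(ℤ³)`. -/
def Rung (k : ℕ) : Prop := ∀ v : Site 3, theta (gridGraph k) v (criticalProbI 3) = 0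

/-- The crux is literally `∃ k ≥ 2, Rung k`. -/
theorem portalGridRung_iff : PortalGridRung ↔ ∃ k : ℕ, 2 ≤ k ∧ Rung k := Iff.rfl

/-! ## Edge deletion lowers `θ` (restriction coupling, via the Lyons–Peres covering inequality) -/

/-- Deleting MORE edges can only lower `θ`: for `E ⊆ E'`,
`θ_{G ∖ E'}(w, p) ≤ θ_{G ∖ E}(w, p)` — the identity map is a weak covering from the richer graph onto
the poorer one (`LyonsPeres647.theta_le_of_surjOn_neighborSet`). -/
theorem theta_deleteEdges_mono (G : SimpleGraph (Site 3)) {E E' : Set (Sym2 (Site 3))} (hEE' : E ⊆ E')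
    (w : Site 3) (p : unitInterval) :
    theta (G.deleteEdges E') w p ≤ theta (G.deleteEdges E) w p := by
  refine LyonsPeres647.theta_le_of_surjOn_neighborSet (G.deleteEdges E) (G.deleteEdges E') id
    (fun x => ?_) w p
  intro y hy
  refine ⟨y, ?_, rfl⟩
  rw [SimpleGraph.mem_neighborSet, SimpleGraph.deleteEdges_adj] at hy ⊢
  exact ⟨hy.1, fun h => hy.2 (hEE' h)⟩

/-- Deleting edges of `ℤ³` can only lower `θ`: `θ_{ℤ³ ∖ E}(w, p) ≤ θ_{ℤ³}(w, p)`. -/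
theorem theta_deleteEdges_le (E : Set (Sym2 (Site 3))) (w : Site 3) (p : unitInterval) :
    theta ((zdGraph 3).deleteEdges E) w p ≤ theta (zdGraph 3) w p := by
  have h := theta_deleteEdges_mono (zdGraph 3) (Set.empty_subset E) w p
  rwa [SimpleGraph.deleteEdges_empty] at h

/-- `θ ≥ 0` on the riveted lattice. -/
theorem theta_gridGraph_nonneg (k : ℕ) (v : Site 3) (p : unitInterval) :
    0 ≤ theta (gridGraph k) v p :=
  measureReal_nonneg

/-- `θ_{G_{Π_k}} ≤ θ_{ℤ³}`. -/
theorem theta_gridGraph_le (k : ℕ) (v : Site 3) (p : unitInterval) :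
    theta (gridGraph k) v p ≤ theta (zdGraph 3) v p :=
  theta_deleteEdges_le _ v p

/-! ## (T1) The `k = 1` member is the summit; the family is monotone; the summit implies every rung -/

/-- `Π_1` is the whole plane: nothing is sealed. -/
theorem gridWall_one : gridWall 1 = ∅ := by
  ext e
  simp [gridWall]

/-- `G_{Π_1} = ℤ³`. -/
theorem gridGraph_one : gridGraph 1 = zdGraph 3 := by
  rw [gridGraph, gridWall_one, SimpleGraph.deleteEdges_empty]

/-- **(T1a)** The `k = 1` member of the rung family IS the sub-problem statement `θ_{ℤ³}(p_c) = 0`. -/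
theorem rung_one_iff : Rung 1 ↔ _root_.PercolationContinuityZ3 := by
  constructor
  · intro h
    have h0 := h 0
    rwa [gridGraph_one] at h0
  · intro h v
    rw [gridGraph_one, theta_zdGraph_eq_theta_zero]
    exact h

/-- Finer grids seal more: `k ∣ k' → gridWall k ⊆ gridWall k'`. -/
theorem gridWall_mono {k k' : ℕ} (h : k ∣ k') : gridWall k ⊆ gridWall k' := by
  rintro e ⟨x, hx0, hx, rfl⟩
  refine ⟨x, hx0, ?_, rfl⟩
  intro hx'
  apply hx
  have hk : (k : ℤ) ∣ (k' : ℤ) := Int.natCast_dvd_natCast.mpr h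
  exact ⟨hk.trans hx'.1, hk.trans hx'.2⟩

/-- **(T1b)** The rung family is monotone along divisibility: `k ∣ k' → Rung k → Rung k'`. -/
theorem rung_of_dvd {k k' : ℕ} (h : k ∣ k') (hk : Rung k) : Rung k' := by
  intro v
  refine le_antisymm ?_ (theta_gridGraph_nonneg k' v _)
  calc theta (gridGraph k') v (criticalProbI 3)
      ≤ theta (gridGraph k) v (criticalProbI 3) :=
        theta_deleteEdges_mono (zdGraph 3) (gridWall_mono h) v _
    _ = 0 := hk v

/-- **(T1c)** The summit conjunct implies EVERY rung (`S = Rung 1` and `1 ∣ k`). -/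
theorem rung_of_continuity (h : _root_.PercolationContinuityZ3) (k : ℕ) : Rung k :=
  rung_of_dvd (one_dvd k) (rung_one_iff.2 h)

/-- **(T1d)** The crux is a corollary of the summit conjunct. -/
theorem portalGridRung_of_continuity (h : _root_.PercolationContinuityZ3) : PortalGridRung :=
  portalGridRung_iff.2 ⟨2, le_rfl, rung_of_continuity h 2⟩

/-- **(T1e)** Contrapositive: any refutation of the crux is the summit's negative resolution. -/
theorem theta_pos_of_not_portalGridRung (h : ¬ PortalGridRung) :
    0 < theta (zdGraph 3) (0 : Site 3) (criticalProbI 3) :=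
  lt_of_le_of_ne measureReal_nonneg (fun h0 => h (portalGridRung_of_continuity h0.symm))

/-! ## (T2) The riveted lattice has the SAME critical point as `ℤ³`, for every `k` -/

/-- The half-space `ℍ = {x₀ ≥ 0}` sees no sealed edge: `G_{Π_k}[ℍ] = ℤ³[ℍ]`. -/
theorem induce_halfSpace_gridGraph (k : ℕ) :
    (gridGraph k).induce (halfSpace 3) = halfSpaceGraph 3 := by
  ext x y
  simp only [SimpleGraph.comap_adj, Function.Embedding.coe_subtype, gridGraph,
    SimpleGraph.deleteEdges_adj, and_iff_left_iff_imp]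
  intro _ hmem
  obtain ⟨z, hz0, -, hz⟩ := hmem
  have hx : (0 : ℤ) ≤ (x : Site 3) 0 := x.2
  have hy : (0 : ℤ) ≤ (y : Site 3) 0 := y.2
  have hlow : (z - Pi.single 0 1 : Site 3) 0 = z 0 - 1 := by simp
  rcases Sym2.eq_iff.mp hz with ⟨hxz, hyz⟩ | ⟨hxz, hyz⟩
  · rw [hyz, hlow] at hy
    rw [hxz] at hx
    omega
  · rw [hxz, hlow] at hx
    rw [hyz] at hy
    omega

/-- `θ_ℍ ≤ θ_{G_{Π_k}}` on the half-space (restriction coupling for the induced subgraph). -/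
theorem theta_halfSpace_le_gridGraph (k : ℕ) (x : halfSpace 3) (p : unitInterval) :
    theta (halfSpaceGraph 3) x p ≤ theta (gridGraph k) x p := by
  rw [← induce_halfSpace_gridGraph k]
  exact theta_induce_le_holds (gridGraph k) (halfSpace 3) x x.2 p

/-- **(T2a)** `p_c(G_{Π_k}, 0) = p_c(ℤ³, 0)` for every spacing `k`: the sandwich
`ℍ ⊆ G_{Π_k} ⊆ ℤ³` and `p_c(ℍ) = p_c(ℤ³)` (Grimmett–Marstrand / Barsky–Grimmett–Newman, in tree). -/
theorem criticalProb_gridGraph_eq (k : ℕ) :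
    criticalProb (gridGraph k) (0 : Site 3) = criticalProb (zdGraph 3) (0 : Site 3) := by
  refine le_antisymm ?_ ?_
  · calc criticalProb (gridGraph k) (0 : Site 3)
        ≤ criticalProb (halfSpaceGraph 3) (halfSpaceOrigin 3) :=
          criticalProb_le_of_theta_pos_imp fun p hp =>
            hp.trans_le (theta_halfSpace_le_gridGraph k (halfSpaceOrigin 3) p)
      _ = criticalProb (zdGraph 3) (0 : Site 3) := GrimmettMarstrand1990_halfSpace_holds 3 (by norm_num)
  · exact criticalProb_le_of_theta_pos_imp fun p hp => hp.trans_le (theta_gridGraph_le k 0 p)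

/-- **(T2b)** Below `p_c(ℤ³)` no riveted lattice percolates anywhere. -/
theorem theta_gridGraph_eq_zero_of_lt (k : ℕ) (v : Site 3) (p : unitInterval)
    (hp : (p : ℝ) < (criticalProbI 3 : ℝ)) : theta (gridGraph k) v p = 0 := by
  have hZ : theta (zdGraph 3) v p = 0 := by
    rw [theta_zdGraph_eq_theta_zero p v]
    exact theta_eq_zero_of_lt_criticalProb_holds (zdGraph 3) (0 : Site 3) p hp
  exact le_antisymm ((theta_gridGraph_le k v p).trans_eq hZ) (theta_gridGraph_nonneg k v p)

/-- **(T2c)** Above `p_c(ℤ³)` every riveted lattice percolates (already inside the half-space). -/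
theorem theta_gridGraph_pos_of_lt (k : ℕ) (p : unitInterval)
    (hp : (criticalProbI 3 : ℝ) < (p : ℝ)) : 0 < theta (gridGraph k) (0 : Site 3) p :=
  (theta_halfSpace_pos_of_criticalProb_lt (d := 3) (by norm_num) p hp).trans_le
    (theta_halfSpace_le_gridGraph k (halfSpaceOrigin 3) p)

/-- `p_c` of the riveted lattice as a point of `[0, 1]` is `criticalProbI 3`. -/
theorem criticalProbIOf_gridGraph_eq (k : ℕ) :
    criticalProbIOf (gridGraph k) (0 : Site 3) = criticalProbI 3 :=
  Subtype.ext (criticalProb_gridGraph_eq k)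

/-- **(T2d) THE COSTUME THEOREM.** The crux is literally "`θ = 0` at the critical point OF THE RIVETED
LATTICE ITSELF" — continuity of the percolation phase transition of `G_{Π_k}` for some `k ≥ 2`,
the summit's own question (`k = 1`, `rung_one_iff`) asked of another 3D cubic lattice graph. -/
theorem portalGridRung_iff_continuity_at_own_threshold :
    PortalGridRung ↔
      ∃ k : ℕ, 2 ≤ k ∧ ∀ v : Site 3, theta (gridGraph k) v (criticalProbIOf (gridGraph k) 0) = 0 := by
  simp only [portalGridRung_iff, Rung, criticalProbIOf_gridGraph_eq]

/-! ## (T3) The registered line's load-bearing stub is the crux -/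

/-- `OpenPhase k`: the percolating phase of `G_{Π_k}` is open from the left (BGN Thm 1.2 (i) one rung
up; verbatim the `k`-th instance of `GridOpenPhase` in `Lines/birth.lean`). -/
def OpenPhase (k : ℕ) : Prop :=
  ∀ p : unitInterval, (∃ v : Site 3, 0 < theta (gridGraph k) v p) →
    ∃ p' : unitInterval, (p' : ℝ) < (p : ℝ) ∧ ∃ w : Site 3, 0 < theta (gridGraph k) w p'

/-- `GridOpenPhase` verbatim as registered in `Lines/birth.lean` (`stub_gridOpenPhase`). -/
def GridOpenPhase : Prop := ∃ k : ℕ, 2 ≤ k ∧ OpenPhase k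

/-- Open phase ⇒ rung (Grimmett p. 169 run on `G_{Π_k}`; as `Birth.PortalGridRung_of`). -/
theorem rung_of_openPhase {k : ℕ} (hop : OpenPhase k) : Rung k := by
  intro v
  by_contra hne
  have hpos : 0 < theta (gridGraph k) v (criticalProbI 3) :=
    lt_of_le_of_ne (theta_gridGraph_nonneg k v _) (Ne.symm hne)
  obtain ⟨p', hp', w, hw⟩ := hop (criticalProbI 3) ⟨v, hpos⟩
  exact hw.ne' (theta_gridGraph_eq_zero_of_lt k w p' hp')

/-- Rung ⇒ open phase: away from `p_c` openness is automatic (T2b/T2c); at `p_c` it is the rung. -/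
theorem openPhase_of_rung {k : ℕ} (hk : Rung k) : OpenPhase k := by
  rintro p ⟨v, hv⟩
  rcases lt_trichotomy (p : ℝ) (criticalProbI 3 : ℝ) with hlt | heq | hgt
  · exact absurd (theta_gridGraph_eq_zero_of_lt k v p hlt) hv.ne'
  · have hpc : p = criticalProbI 3 := Subtype.ext heq
    subst hpc
    exact absurd (hk v) hv.ne'
  · obtain ⟨q, hq1, hq2⟩ := exists_between hgt
    have hq0 : 0 ≤ q := (criticalProbI 3).2.1.trans hq1.le
    have hq1' : q ≤ 1 := hq2.le.trans p.2.2
    exact ⟨⟨q, hq0, hq1'⟩, hq2, 0, theta_gridGraph_pos_of_lt k ⟨q, hq0, hq1'⟩ hq1⟩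

/-- **(T3)** The only registered line's hard stub is EQUIVALENT to the crux. -/
theorem gridOpenPhase_iff_portalGridRung : GridOpenPhase ↔ PortalGridRung := by
  rw [portalGridRung_iff]
  exact exists_congr fun k => and_congr_right fun _ => ⟨rung_of_openPhase, openPhase_of_rung⟩

end Summit.CriticalPhenomena.PercolationContinuityZ3.Cruxes.PortalGridRung.Costume

end
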